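import Mathlib
import HarnessLib
import Literature.NumberTheory.LFunctions.MuentzFormulaStrip
import Summits.RiemannHypothesis.RiemannHypothesis.Theorems.IntegerScrewSmoothSectorDefs
import Summits.RiemannHypothesis.RiemannHypothesis.Theorems.ScrewLemmaKProfileBernoulli
import Summits.RiemannHypothesis.RiemannHypothesis.Theorems.SmoothSectorHardyProfileMuentz

/-!
# Müntz for the lattice profile on `Re w > 0` and the generator integration by parts (K1 support; v5 §4)

(a) `𝓜h(w) = ζ(w)·𝓜(g·1_(0,1])(w)` for `Re w > 0`, `w ≠ 1` — the tree's
`Literature.NumberTheory.LFunctions.mellin_tsum_indicator_comp_mul_nat` (Titchmarsh (2.11.1), case `∫F = 0`)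
applied to `F₀ = g` on `[0,1]`, after identifying the Müntz sum with `latticeProfile`;
(b) `𝓜(g·1_(0,1])(w) = −(1/w)·∫₀¹ g′(u) u^w du` for `Re w > 0` (integration by parts, `g(1) = 0`).
These are stated for `g ∈ C¹[0,1]` with `g(1) = 0`, `∫g = 0` (NOT the full admissibility of route
SmoothSectorHardy's `mellin_latticeProfile_eq` / `integral_mul_cpow_eq_of_admissible`, which also assume the
`u^{-1/2}`-moment): the density step for K1 applies them to differences of approximants, which have no moment
condition.

Ported verbatim (tree conventions: docstrings, ≤ 400-line files) from rh-idea-5 g0's desk file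
`pub/ideators/rh-idea-5/ProfileBernoulli.lean` v5 (sha16 4e6baba130239d85, lean check rc 0), in support of
item stmt-RiemannHypothesis-21612 `CoprofileIsometry` (K1 of route ScrewLemmaKCoprofile; shared with
ScrewLemmaKExtremalRay); §1 is the tree's `ScrewLemmaKProfileBernoulli` (k1-w3), §§2–3 its `…Defs` / `…C2`.
RH-free real/complex analysis: this is NOT a proof of RH and nothing here bears on the truth of RH.
-/

noncomputable section

set_option linter.dupNamespace false

namespace Summit.RiemannHypothesis.RiemannHypothesis.Theorems.IntegerScrew.ProfileBernoulli

open MeasureTheory Set intervalIntegral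
open Summit.RiemannHypothesis.RiemannHypothesis.Theorems.IntegerScrew
open scoped BigOperators

open Summit.RiemannHypothesis.RiemannHypothesis.Theorems.SmoothSectorHardy (tsum_indicator_eq_latticeProfile)

/-! ## Müntz for the profile on `Re w > 0` and the generator IBP

(a) `𝓜h(w) = ζ(w)·𝓜(g·1_(0,1])(w)` for `Re w > 0`, `w ≠ 1` — the tree's
`Literature.NumberTheory.LFunctions.mellin_tsum_indicator_comp_mul_nat` (Titchmarsh (2.11.1), case `∫F = 0`)
applied to `F₀ = g` on `[0,1]`, after identifying the Müntz sum with `latticeProfile`;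
(b) `𝓜(g·1_(0,1])(w) = −(1/w)·∫₀¹ g′(u) u^w du` for `Re w > 0` (integration by parts, `g(1) = 0`). -/

-- `tsum_indicator_eq_latticeProfile` (the Müntz sum of the indicator data is `latticeProfile`) is the
-- tree's `SmoothSectorHardy.tsum_indicator_eq_latticeProfile` (identical statement, file `SmoothSectorHardyProfileMuentz`).

/-- (a) MÜNTZ FOR THE PROFILE on `Re w > 0`, `w ≠ 1`:
`MellinConvergent h w` and `𝓜h(w) = ζ(w)·𝓜(g·1_(0,1])(w)`. [folklore] -/
theorem mellin_latticeProfile {g : ℝ → ℝ} (hC : ContDiffOn ℝ 1 g (Icc 0 1))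
    (hI : ∫ u in (0:ℝ)..1, g u = 0) {w : ℂ} (hw : 0 < w.re) (hw1 : w ≠ 1) :
    MellinConvergent (fun y => ((latticeProfile g y : ℝ) : ℂ)) w ∧
      mellin (fun y => ((latticeProfile g y : ℝ) : ℂ)) w
        = riemannZeta w * mellin ((Ioc (0:ℝ) 1).indicator fun u => ((g u : ℝ) : ℂ)) w := by
  obtain ⟨L, hL⟩ :=
    Literature.NumberTheory.LFunctions.exists_lipschitzOnWith_of_contDiffOn_Icc zero_lt_one hC le_rfl
  have hLip : LipschitzOnWith (1 * L) (fun u => ((g u : ℝ) : ℂ)) (Icc 0 1) :=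
    Complex.isometry_ofReal.lipschitz.comp_lipschitzOnWith hL
  have hint : ∫ t in (0:ℝ)..1, ((g t : ℝ) : ℂ) = 0 := by
    rw [intervalIntegral.integral_ofReal, hI]; simp
  obtain ⟨h1, h2⟩ :=
    Literature.NumberTheory.LFunctions.mellin_tsum_indicator_comp_mul_nat zero_lt_one hLip hint hw hw1
  have hEq : EqOn (fun x => ∑' n : ℕ, (Ioc (0:ℝ) 1).indicator (fun u => ((g u : ℝ) : ℂ))
      (((n + 1 : ℕ) : ℝ) * x)) (fun y => ((latticeProfile g y : ℝ) : ℂ)) (Ioi 0) :=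
    fun y hy => tsum_indicator_eq_latticeProfile g hy
  have hEq' : EqOn (fun x : ℝ => (x : ℂ) ^ (w - 1) • ∑' n : ℕ, (Ioc (0:ℝ) 1).indicator
      (fun u => ((g u : ℝ) : ℂ)) (((n + 1 : ℕ) : ℝ) * x))
      (fun y : ℝ => (y : ℂ) ^ (w - 1) • ((latticeProfile g y : ℝ) : ℂ)) (Ioi 0) := by
    intro y hy; simp only [hEq hy]
  refine ⟨?_, ?_⟩
  · exact IntegrableOn.congr_fun h1 hEq' measurableSet_Ioi
  · rw [← h2]
    exact (setIntegral_congr_fun measurableSet_Ioi hEq').symm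

/-- (b) GENERATOR IBP: `𝓜(g·1_(0,1])(w) = −(1/w)·∫₀¹ g′(u) u^w du` for `Re w > 0` (`g(1) = 0`). [folklore] -/
theorem mellin_indicator_eq_generator {g : ℝ → ℝ} (hC : ContDiffOn ℝ 1 g (Icc 0 1)) (h1 : g 1 = 0)
    {w : ℂ} (hw : 0 < w.re) :
    mellin ((Ioc (0:ℝ) 1).indicator fun u => ((g u : ℝ) : ℂ)) w
      = -(1 / w) * ∫ u in Ioo (0:ℝ) 1, ((deriv g u : ℝ) : ℂ) * (u : ℂ) ^ w := by
  have hw0 : w ≠ 0 := by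
    intro h; rw [h] at hw; simp at hw
  -- left side as an interval integral
  have hL : mellin ((Ioc (0:ℝ) 1).indicator fun u => ((g u : ℝ) : ℂ)) w
      = ∫ u in (0:ℝ)..1, (u : ℂ) ^ (w - 1) * ((g u : ℝ) : ℂ) := by
    rw [mellin, intervalIntegral.integral_of_le zero_le_one,
      ← MeasureTheory.integral_indicator measurableSet_Ioc]
    have : (Ioc (0:ℝ) 1) ⊆ Ioi 0 := fun u hu => hu.1
    rw [← MeasureTheory.integral_indicator measurableSet_Ioi]
    congr 1
    funext u
    by_cases hu : u ∈ Ioc (0:ℝ) 1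
    · rw [indicator_of_mem (this hu), indicator_of_mem hu, indicator_of_mem hu, smul_eq_mul]
    · rw [indicator_of_notMem hu]
      by_cases hu' : u ∈ Ioi (0:ℝ)
      · rw [indicator_of_mem hu', indicator_of_notMem hu, smul_zero]
      · rw [indicator_of_notMem hu']
  -- right side as an interval integral
  have hR : (∫ u in Ioo (0:ℝ) 1, ((deriv g u : ℝ) : ℂ) * (u : ℂ) ^ w)
      = ∫ u in (0:ℝ)..1, (u : ℂ) ^ w * ((deriv g u : ℝ) : ℂ) := by
    rw [intervalIntegral.integral_of_le zero_le_one, integral_Ioc_eq_integral_Ioo]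
    exact setIntegral_congr_fun measurableSet_Ioo fun u _ => by ring
  rw [hL, hR]
  -- integration by parts on [0,1]
  have hu : ContinuousOn (fun x : ℝ => (x : ℂ) ^ w) (uIcc 0 1) := by
    intro x _
    exact (Complex.continuousAt_ofReal_cpow_const x w (Or.inl hw)).continuousWithinAt
  have hv : ContinuousOn (fun x => ((g x : ℝ) : ℂ)) (uIcc 0 1) := by
    rw [uIcc_of_le zero_le_one]
    exact Complex.continuous_ofReal.comp_continuousOn hC.continuousOn
  have huu' : ∀ x ∈ Ioo (min 0 1 : ℝ) (max 0 1),
      HasDerivWithinAt (fun x : ℝ => (x : ℂ) ^ w) (w * (x : ℂ) ^ (w - 1)) (Ioi x) x := by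
    intro x hx
    rw [min_eq_left zero_le_one, max_eq_right zero_le_one] at hx
    exact (hasDerivAt_ofReal_cpow_const hx.1.ne' hw0).hasDerivWithinAt
  have hvv' : ∀ x ∈ Ioo (min 0 1 : ℝ) (max 0 1),
      HasDerivWithinAt (fun x => ((g x : ℝ) : ℂ)) (((deriv g x : ℝ) : ℂ)) (Ioi x) x := by
    intro x hx
    rw [min_eq_left zero_le_one, max_eq_right zero_le_one] at hx
    exact (hasDerivAt_of_contDiffOn hC hx).ofReal_comp.hasDerivWithinAt
  have hu' : IntervalIntegrable (fun x : ℝ => w * (x : ℂ) ^ (w - 1)) volume 0 1 :=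
    (intervalIntegrable_cpow' (by simp; linarith)).const_mul w
  have hv' : IntervalIntegrable (fun x => ((deriv g x : ℝ) : ℂ)) volume 0 1 :=
    ⟨MeasureTheory.Integrable.ofReal (intervalIntegrable_deriv hC).1,
      MeasureTheory.Integrable.ofReal (intervalIntegrable_deriv hC).2⟩
  have hibp := intervalIntegral.integral_mul_deriv_eq_deriv_mul_of_hasDeriv_right hu hv huu' hvv' hu' hv'
  -- hibp : ∫ x^w * g' = 1^w g 1 - 0^w g 0 - ∫ (w x^(w-1)) * g
  have e : (∫ x in (0:ℝ)..1, w * (x : ℂ) ^ (w - 1) * ((g x : ℝ) : ℂ))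
      = w * ∫ x in (0:ℝ)..1, (x : ℂ) ^ (w - 1) * ((g x : ℝ) : ℂ) := by
    rw [← intervalIntegral.integral_const_mul]
    exact intervalIntegral.integral_congr fun x _ => by ring
  rw [hibp, h1, e]
  simp only [Complex.ofReal_zero, Complex.ofReal_one, Complex.zero_cpow hw0, Complex.one_cpow, mul_zero,
    zero_mul, sub_zero, zero_sub]
  field_simp



end Summit.RiemannHypothesis.RiemannHypothesis.Theorems.IntegerScrew.ProfileBernoulli

end
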